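import Literature.Geometry.Riemannian.ParabolicBallCovering
import HarnessLib

/-!
# Covering by `P*`-parabolic balls (Bamler 2020a, §9.1, arXiv v1 Thm. 36)

R. Bamler, *Entropy and heat kernel bounds on a Ricci flow background*, arXiv:2008.07093 (2020a),
§9.1, arXiv v1 Thm. 36: *"Let `λ₀ > 0`, `A, T^± ≥ 0` and consider a point `(x₀, t₀) ∈ M × I` and a
scale `r > 0` with `[t₀ − (T⁻ + λ₀²) r², t₀] ⊂ I`. Then for any subset
`X ⊂ P*(x₀, t₀; A r, −T⁻ r², T⁺ r²)` and `λ ∈ (0, λ₀]` we can find points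
`(y_1, s_1), …, (y_N, s_N) ∈ X` with the property that `X ⊂ ⋃_{i=1}^N P*(y_i, s_i; λ r)`,
`N ≤ C(A, T⁻, T⁺, λ₀) λ^{−n−2}`."*

This file proves the covering statement for the metric flow `𝒳 = ricciFlowMetricFlow hh hR _ hflow`
of a Ricci flow on a closed manifold (`exists_cover_pParabolicBall_card_mul_pow_le`), exactly as
printed (§9.2, first paragraph of the proof): by the packing bound
`exists_card_mul_pow_le_of_disjoint_pParabolicBall` (`ParabolicBallCovering.lean`, the rest of the
printed proof) the size of a family of points of `X` with pairwise disjoint balls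
`P*(y_i, s_i; λ r / 3)` is bounded by `C (λ/3)^{−m−2}`; a family of maximal size
(`Nat.findGreatest`) covers: every `(y', s') ∈ X` has `P*(y', s'; λr/3) ∩ P*(y_i, s_i; λr/3) ≠ ∅`
for some `i`, whence `(y', s') ∈ P*(y', s'; λr/3) ⊂ P*(y_i, s_i; λ r)` by Prop. 9.3 (d)
(`MetricFlow.IsHConcentrated.pParabolicBall_subset_of_mem_of_mem`). As in
`ParabolicBallCovering.lean` the hypotheses carry the slack of the tree's bricks: the flow must live
on `[t₀ − (T⁻ + 2λ₀²) r², t₀ + T⁺ r²] ⊂ (a, T)` with `R ≥ R_min` there, `−R_min (T⁻ + 2λ₀² + T⁺) r² ≤ Λ`,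
and the bound reads `N λ^{m+2} ≤ C(m, Λ, A, T⁻, T⁺, λ₀)`.

Everything is proved; no definitions, no named facts.

## References

* R. H. Bamler, *Entropy and heat kernel bounds on a Ricci flow background*, arXiv:2008.07093
  (2020), §9.1, Prop. 9.3 (d), arXiv v1 Thm. 36, and its proof in §9.2. [Bamler2020Entropy]
* R. H. Bamler, *Compactness theory of the space of super Ricci flows*, Invent. Math. 233 (2023),
  1121–1277, §3.5 (`P*`-parabolic neighbourhoods). [Bamler2023]
-/

noncomputable section

open Set Filter Function MeasureTheory Measure
open scoped Manifold ContDiff Topology ENNReal NNReal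

namespace Literature.Geometry.Riemannian

open Lorentzian Lorentzian.PseudoRiemannianMetric

/-- **Bamler 2020a, §9.1, arXiv v1 Thm. 36: covering by `P*`-parabolic balls.** For `m ≥ 3`,
`Λ ≥ 0`, `A, T⁻, T⁺ ≥ 0` and `λ₀ > 0` there is `C = C(m, Λ, A, T⁻, T⁺, λ₀) > 0` such that: for every
Ricci flow `hflow` on `[a, T]` of a smooth family of Riemannian metrics on a closed connected
manifold modelled on `ℝᵐ` with metric flow `𝒳 = ricciFlowMetricFlow hh hR _ hflow`, every `x₀ ∈ M`,
`t₀`, `r > 0` with `a < t₀ − (T⁻ + 2λ₀²) r²`, `t₀ + T⁺ r² < T`, `R ≥ R_min` on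
`M × [t₀ − (T⁻ + 2λ₀²) r², t₀ + T⁺ r²]` with `−R_min (T⁻ + 2λ₀² + T⁺) r² ≤ Λ`, every `λ ∈ (0, λ₀]`
and every subset `X ⊆ P*(x₀, t₀; A r, −T⁻ r², T⁺ r²)` there are finitely many points
`p_1, …, p_N ∈ X` with

  `X ⊆ ⋃ᵢ P*(p_i; λ r)`  and  `N λ^{m+2} ≤ C`  (i.e. `N ≤ C λ^{−m−2}`).

Proof (§9.2): a family of points of `X` with pairwise disjoint `P*(p_i; λr/3)` of maximal size
(bounded by the packing theorem `exists_card_mul_pow_le_of_disjoint_pParabolicBall`) covers, by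
maximality and Prop. 9.3 (d) (`IsHConcentrated.pParabolicBall_subset_of_mem_of_mem`:
`P*(p'; λr/3) ∩ P*(p_i; λr/3) ≠ ∅` implies `p' ∈ P*(p'; λr/3) ⊆ P*(p_i; λ r)`).
[cite: Bamler2020Entropy, §9.1, arXiv v1 Thm. 36; §9.2, proof of Thm. 36] -/
theorem exists_cover_pParabolicBall_card_mul_pow_le (m : ℕ) (hm : 3 ≤ m)
    {Λ A Tm Tp l₀ : ℝ} (hΛ : 0 ≤ Λ) (hA : 0 ≤ A) (hTm : 0 ≤ Tm) (hTp : 0 ≤ Tp) (hl₀ : 0 < l₀) :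
    ∃ C : ℝ, 0 < C ∧ ∀ {M : Type*} [TopologicalSpace M]
      [ChartedSpace (EuclideanSpace ℝ (Fin m)) M]
      [IsManifold 𝓘(ℝ, EuclideanSpace ℝ (Fin m)) ∞ M] [T2Space M] [CompactSpace M]
      [SecondCountableTopology M] [MeasurableSpace M] [BorelSpace M] [ConnectedSpace M]
      {h : ℝ → PseudoRiemannianMetric 𝓘(ℝ, EuclideanSpace ℝ (Fin m)) ∞ (EuclideanSpace ℝ (Fin m))
        (TangentSpace 𝓘(ℝ, EuclideanSpace ℝ (Fin m)) : M → Type _)}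
      {cov : ℝ → CovariantDerivative 𝓘(ℝ, EuclideanSpace ℝ (Fin m)) (EuclideanSpace ℝ (Fin m))
        (TangentSpace 𝓘(ℝ, EuclideanSpace ℝ (Fin m)) : M → Type _)}
      {a T : ℝ} (hflow : IsRicciFlow h cov (Icc a T)) (hh : IsContMDiffFamilyOn ∞ h univ)
      (hR : ∀ r, (h r).IsRiemannian),
      ∀ {t₀ r : ℝ} (ht₀ : t₀ ∈ Icc a T) (hb : t₀ - Tm * r ^ 2 ∈ Icc a T),
      0 < r → a < t₀ - (Tm + 2 * l₀ ^ 2) * r ^ 2 → t₀ + Tp * r ^ 2 < T →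
      ∀ {Rmin : ℝ}, (∀ s ∈ Icc (t₀ - (Tm + 2 * l₀ ^ 2) * r ^ 2) (t₀ + Tp * r ^ 2), ∀ z : M,
        Rmin ≤ (h s).scalarCurvatureWith (cov s) z) →
      -Rmin * ((Tm + 2 * l₀ ^ 2 + Tp) * r ^ 2) ≤ Λ → ∀ (x₀ : M) {l : ℝ}, 0 < l → l ≤ l₀ →
      ∀ X ⊆ (ricciFlowMetricFlow hh hR Set.ordConnected_Icc hflow).pParabolicNhd
        ⟨⟨t₀, ht₀⟩, x₀⟩ (A * r) (Tm * r ^ 2) (Tp * r ^ 2) hb,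
      ∃ (N : ℕ) (q : Fin N → (ricciFlowMetricFlow hh hR Set.ordConnected_Icc hflow).Pt)
        (hq : ∀ i, ((q i).1 : ℝ) - (l * r) ^ 2 ∈ Icc a T),
        (∀ i, q i ∈ X) ∧
        X ⊆ ⋃ i, (ricciFlowMetricFlow hh hR Set.ordConnected_Icc hflow).pParabolicBall (q i)
          (l * r) (hq i) ∧
        (N : ℝ) * l ^ (m + 2) ≤ C := by
  classical
  obtain ⟨C₀, hC₀, PACK⟩ :=
    exists_card_mul_pow_le_of_disjoint_pParabolicBall m hm hΛ hA hTm hTp hl₀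
  refine ⟨C₀ * 3 ^ (m + 2), by positivity, ?_⟩
  intro M _ _ _ _ _ _ _ _ _ h cov a T hflow hh hR t₀ r ht₀ hb hr hs₁a hTT Rmin hRmin hRΛ x₀ l hl
    hll₀ X hX
  let 𝒳 : MetricFlow (Icc a T) := ricciFlowMetricFlow hh hR Set.ordConnected_Icc hflow
  have hm0 : 0 < m := by omega
  have hH : 𝒳.IsHConcentrated (MetricFlow.concentrationConst m) :=
    ricciFlowMetricFlow_isHConcentrated hm0 hh hR Set.ordConnected_Icc hflow
  have hr2 : 0 < r ^ 2 := pow_pos hr 2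
  have hl₀2 : 0 < l₀ ^ 2 := pow_pos hl₀ 2
  -- the side conditions `𝔱(q) − ρ² ∈ [a, T]` for points of `P*(x₀, t₀; A r, −T⁻ r², T⁺ r²)`
  have hside : ∀ q ∈ X, ∀ ρ : ℝ, ρ ^ 2 ≤ l₀ ^ 2 * r ^ 2 → ((q.1 : ℝ) - ρ ^ 2) ∈ Icc a T := by
    intro q hq ρ hρ
    have h1 : t₀ - Tm * r ^ 2 ≤ (q.1 : ℝ) := (hX hq).1.1
    refine ⟨?_, ?_⟩
    · nlinarith only [h1, hρ, hs₁a, hl₀2, hr2]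
    · nlinarith only [q.1.2.2, sq_nonneg ρ]
  set l₃ : ℝ := l / 3 with hl₃
  have hl₃0 : 0 < l₃ := by positivity
  have hl₃l₀ : l₃ ≤ l₀ := by rw [hl₃]; linarith only [hll₀, hl]
  have hll : l ^ 2 ≤ l₀ ^ 2 := pow_le_pow_left₀ hl.le hll₀ 2
  have hlr : (l * r) ^ 2 ≤ l₀ ^ 2 * r ^ 2 := by rw [mul_pow]; nlinarith only [hll, hr2]
  have h9 : (l₃ * r) ^ 2 ≤ l₀ ^ 2 * r ^ 2 := by
    rw [mul_pow, hl₃]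
    nlinarith only [hll, hr2, hl]
  have e3 : 2 * (l₃ * r) + l₃ * r = l * r := by rw [hl₃]; ring
  -- packings of `X` by balls of radius `λ r / 3`
  let IsPacking : ℕ → Prop := fun n ↦ ∃ (q : Fin n → 𝒳.Pt) (hqX : ∀ i, q i ∈ X),
    ∀ i j, i ≠ j → Disjoint (𝒳.pParabolicBall (q i) (l₃ * r) (hside _ (hqX i) _ h9))
      (𝒳.pParabolicBall (q j) (l₃ * r) (hside _ (hqX j) _ h9))
  have hP0 : IsPacking 0 := ⟨Fin.elim0, fun i ↦ i.elim0, fun i ↦ i.elim0⟩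
  have hbound : ∀ n, IsPacking n → (n : ℝ) * l₃ ^ (m + 2) ≤ C₀ := by
    intro n hn
    obtain ⟨q, hqX, hd⟩ := hn
    exact PACK hflow hh hR ht₀ hb hr hs₁a hTT hRmin hRΛ x₀ hl₃0 hl₃l₀ q
      (fun i ↦ hside _ (hqX i) _ h9) (fun i ↦ hX (hqX i)) hd
  obtain ⟨Bn, hBn⟩ := exists_nat_ge (C₀ / l₃ ^ (m + 2))
  have hle : ∀ n, IsPacking n → n ≤ Bn := by
    intro n hn
    have h' : (n : ℝ) ≤ C₀ / l₃ ^ (m + 2) := by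
      rw [le_div_iff₀ (by positivity)]
      exact hbound n hn
    exact_mod_cast h'.trans hBn
  -- a packing of maximal size
  set n₀ : ℕ := Nat.findGreatest IsPacking Bn with hn₀def
  have hn₀ : IsPacking n₀ := Nat.findGreatest_spec (Nat.zero_le Bn) hP0
  have hmax : ¬ IsPacking (n₀ + 1) := fun h1 ↦
    Nat.findGreatest_is_greatest (Nat.lt_succ_self n₀) (hle _ h1) h1
  obtain ⟨q, hqX, hqd⟩ := hn₀
  refine ⟨n₀, q, fun i ↦ hside _ (hqX i) _ hlr, hqX, ?_, ?_⟩
  · -- the maximal packing covers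
    intro x hx
    by_contra hnot
    -- `P*(x; λr/3)` is disjoint from every `P*(q i; λr/3)`
    have hdx : ∀ i, Disjoint (𝒳.pParabolicBall x (l₃ * r) (hside _ hx _ h9))
        (𝒳.pParabolicBall (q i) (l₃ * r) (hside _ (hqX i) _ h9)) := by
      intro i
      by_contra hnd
      obtain ⟨w, hw₁, hw₂⟩ := Set.not_disjoint_iff.1 hnd
      have hsub := hH.pParabolicBall_subset_of_mem_of_mem hw₁ hw₂
        (hside _ (hqX i) _ (by rw [e3]; exact hlr))
      have hx' := hsub (𝒳.mem_pParabolicBall_self x (mul_pos hl₃0 hr) (hside _ hx _ h9))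
      have hx'' : x ∈ 𝒳.pParabolicBall (q i) (l * r) (hside _ (hqX i) _ hlr) :=
        hH.pParabolicNhd_mono (q i) e3.le (sq_nonneg _) (by rw [e3]) (by rw [e3]) _ _ hx'
      exact hnot (Set.mem_iUnion.2 ⟨i, hx''⟩)
    -- so `x, q 0, …, q (n₀ - 1)` is a larger packing
    refine hmax ⟨Fin.cons x q, fun i ↦ Fin.cases hx (fun j ↦ hqX j) i, ?_⟩
    intro i j hij
    induction i using Fin.cases with
    | zero =>
      induction j using Fin.cases with
      | zero => exact absurd rfl hij
      | succ j => exact hdx j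
    | succ i =>
      induction j using Fin.cases with
      | zero => exact (hdx i).symm
      | succ j => exact hqd i j fun hij' ↦ hij (by rw [hij'])
  · -- the cardinality bound
    have e : l ^ (m + 2) = l₃ ^ (m + 2) * 3 ^ (m + 2) := by
      rw [← mul_pow]
      congr 1
      rw [hl₃]
      ring
    rw [e, ← mul_assoc]
    exact mul_le_mul_of_nonneg_right (hbound n₀ ⟨q, hqX, hqd⟩) (by positivity)

end Literature.Geometry.Riemannian

end
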